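import Summits.ResolutionOfSingularities.ResolutionOfSingularities.Theorems.EquisingularLiftEquisingularLiftNatSectionStep
import HarnessLib

/-!
# [OURS · L1 W4.5(b)] EL♮ `EquisingularLiftNat` (stmt-ResolutionOfSingularities-20038), line `sections` — the GENERAL E1-STEP:
# one blow-up along a regular centre whose special points lie in the current strict transform

Helper file `--supports stmt-ResolutionOfSingularities-20038` (toolkit for the carrier game of `stub_elnat_three`: Δ-centres,
combs, sub-lifts and sections are all instances; res-L1-w45b-plan-1 CRUX-PLAN v3 §1.1/§1.7, CHAIN v6.2 §3). NOT a statement of any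
manuscript; OURS plumbing, companion of `…NatSectionStep` (p497593, the section case).

The inductive clause of `EquisingularLiftNat` lets a stage `(X₁, σ₁, Y₁)` over the base `q : P → Spec O` pass to
`(X₂, τ ≫ σ₁, closure (τ⁻¹(Y₁ ∖ supp C)))` for a blow-up `τ : X₂ → X₁` along an ideal sheaf `C` provided
(i) `V(C)` is regular, (ii) `σ₁(supp C)` contains no generic point of `Y`, and (iii) E1: `supp C ∩ (σ₁ ≫ q)⁻¹{s₀} ⊆ Y₁`.
Along a chain starting from an irreducible closed `Y = closure {ξ}`, the fibre of `σ₁` over `ξ` is the single generic point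
`ξ₁` of `Y₁ = closure {ξ₁}` (`Split.Chain.fibre`), so (ii) says exactly `ξ₁ ∉ supp C`, i.e. **the centre does not swallow the
whole strict transform**; given E1 this is the same as «the special support of the centre is a PROPER subset of `Y₁`».

* `natChain_nil` — the empty chain `(P, 𝟙, Y)`;
* `natChain_step` — ONE GENERAL E1-STEP: E1-chain `(X₁, σ₁, Y₁)` + blow-up along a regular centre `C` with
  `supp C ∩ (σ₁ ≫ q)⁻¹{s₀} ⊆ Y₁` and `¬ Y₁ ⊆ supp C` ⟹ E1-chain `(X₂, τ ≫ σ₁, closure (τ⁻¹(Y₁ ∖ supp C)))`;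
* `natChain_step_of_ssubset` — the same with the single hypothesis `supp C ∩ (σ₁ ≫ q)⁻¹{s₀} ⊂ Y₁` (proper subset), using
  that `Y₁` lies in the special fibre (`closure_subset_preimage_of_chain`).

Statements INLINE in the item's vocabulary for a general base `q` (instantiate `P := Proj (MvPolynomial.homogeneousSubmodule
(Fin (n+1)) O)`, `q := Proj.toSpecZero _ ≫ Spec.map (CommRingCat.ofHom (algebraMap O (_ 0)))`).
-/

set_option linter.dupNamespace false -- mandated namespace `Summit.<Summit>.<Problem>` of this single-conjunct summit

noncomputable section

open CategoryTheory CategoryTheory.Limits AlgebraicGeometry TopologicalSpace Topology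
open Literature.AlgebraicGeometry.Resolution
open Summit.ResolutionOfSingularities.ResolutionOfSingularities.Theses.EquisingularLift.Split
open Summit.ResolutionOfSingularities.ResolutionOfSingularities.Cruxes.EquisingularLift.StrataSplit

namespace Summit.ResolutionOfSingularities.ResolutionOfSingularities.Cruxes.EquisingularLiftNat.Sections

/-- **The empty E1-chain** `(P, 𝟙, Y)`. [folklore] -/
theorem natChain_nil {O : Type} [CommRing O] [IsLocalRing O] {P : AlgebraicGeometry.Scheme.{0}} (q : P ⟶ AlgebraicGeometry.Spec (.of O)) (Y : Set P) :
    ∀ Q : (∀ X' : AlgebraicGeometry.Scheme.{0}, (X' ⟶ P) → Set X' → Prop), Q P (CategoryTheory.CategoryStruct.id _) Y → (∀ (X' X'' : AlgebraicGeometry.Scheme.{0}) (σ' : X' ⟶ P) (Y' : Set X') (C : X'.IdealSheafData) (τ : X'' ⟶ X'), Q X' σ' Y' → Literature.AlgebraicGeometry.Resolution.IsBlowup τ C → Literature.AlgebraicGeometry.Resolution.Scheme.IsRegular C.subscheme → σ' '' (C.support : Set X') ⊆ {x | ¬ IsGenericPoint x Y} → (C.support : Set X') ∩ (CategoryTheory.CategoryStruct.comp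 σ' q) ⁻¹' {IsLocalRing.closedPoint O} ⊆ Y' → Q X'' (CategoryTheory.CategoryStruct.comp τ σ') (closure (τ ⁻¹' (Y' \ (C.support : Set X'))))) → Q P (CategoryTheory.CategoryStruct.id _) Y :=
  fun _ h0 _ => h0

/-- **ONE GENERAL E1-STEP.** Let `Y = closure {ξ} ⊆ P`, `(X₁, σ₁, Y₁)` an E1-chain over `(P, Y)` w.r.t. `q : P → Spec O`,
`τ : X₂ → X₁` a blow-up along an ideal sheaf `C` with `V(C)` regular, whose special support lies in `Y₁` (E1) and which does
not contain all of `Y₁`. Then `(X₂, τ ≫ σ₁, closure (τ⁻¹(Y₁ ∖ supp C)))` is an E1-chain over `(P, Y)`: the only point of `X₁`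
over the generic point `ξ` of `Y` is the generic point `ξ₁` of `Y₁ = closure {ξ₁}` (`Chain.fibre`), and `ξ₁ ∈ supp C` would
force `Y₁ ⊆ supp C` (the support is closed). Covers Δ-centres, combs, sub-lifts and sections alike. [folklore] -/
theorem natChain_step {O : Type} [CommRing O] [IsLocalRing O] {P : AlgebraicGeometry.Scheme.{0}} (q : P ⟶ AlgebraicGeometry.Spec (.of O)) {Y : Set P} {ξ : P} (hξ : IsGenericPoint ξ Y) {X₁ X₂ : AlgebraicGeometry.Scheme.{0}} {σ₁ : X₁ ⟶ P} {Y₁ : Set X₁} (h₁ : ∀ Q : (∀ X' : AlgebraicGeometry.Scheme.{0}, (X' ⟶ P) → Set X' → Prop), Q P (CategoryTheory.CategoryStruct.id _) Y → (∀ (X' X'' : AlgebraicGeometry.Scheme.{0}) (σ' : X' ⟶ P) (Y' : Set X') (C : X'.IdealSheafData) (τ : X'' ⟶ X'), Q X' σ' Y' → Literature.AlgebraicGeometry.Resolution.IsBlowup τ C → Literature.AlgebraicGeometry.Resolution.Scheme.IsRegular C.subscheme → σ' '' (C.support : Set X') ⊆ {x | ¬ IsGenericPoint x Y} → (C.support :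 Set X') ∩ (CategoryTheory.CategoryStruct.comp σ' q) ⁻¹' {IsLocalRing.closedPoint O} ⊆ Y' → Q X'' (CategoryTheory.CategoryStruct.comp τ σ') (closure (τ ⁻¹' (Y' \ (C.support : Set X'))))) → Q X₁ σ₁ Y₁) {C : X₁.IdealSheafData} {τ : X₂ ⟶ X₁} (hτ : Literature.AlgebraicGeometry.Resolution.IsBlowup τ C) (hC : Literature.AlgebraicGeometry.Resolution.Scheme.IsRegular C.subscheme) (hE1 : (C.support : Set X₁) ∩ (CategoryTheory.CategoryStruct.comp σ₁ q) ⁻¹' {IsLocalRing.closedPoint O} ⊆ Y₁) (hne : ¬ Y₁ ⊆ (C.support : Set X₁)) :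
    ∀ Q : (∀ X' : AlgebraicGeometry.Scheme.{0}, (X' ⟶ P) → Set X' → Prop), Q P (CategoryTheory.CategoryStruct.id _) Y → (∀ (X' X'' : AlgebraicGeometry.Scheme.{0}) (σ' : X' ⟶ P) (Y' : Set X') (C : X'.IdealSheafData) (τ : X'' ⟶ X'), Q X' σ' Y' → Literature.AlgebraicGeometry.Resolution.IsBlowup τ C → Literature.AlgebraicGeometry.Resolution.Scheme.IsRegular C.subscheme → σ' '' (C.support : Set X') ⊆ {x | ¬ IsGenericPoint x Y} → (C.support : Set X') ∩ (CategoryTheory.CategoryStruct.comp σ' q) ⁻¹' {IsLocalRing.closedPoint O} ⊆ Y' → Q X'' (CategoryTheory.CategoryStruct.comp τ σ') (closure (τ ⁻¹' (Y' \ (C.support : Set X'))))) → Q X₂ (CategoryTheory.CategoryStruct.comp τ σ₁) (closure (τ ⁻¹' (Y₁ \ (C.support : Set X₁)))) := by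
  -- the fibre of `σ₁` over `ξ` is the generic point `ξ₁` of `Y₁ = closure {ξ₁}`
  obtain ⟨ξ₁, hfib, hY₁⟩ := (chain_of_natChain q Y σ₁ Y₁ h₁).fibre hξ
  -- (ii): the image of the centre contains no generic point of `Y`
  have himg : σ₁ '' (C.support : Set X₁) ⊆ {x : P | ¬ IsGenericPoint x Y} := by
    rintro _ ⟨c, hc, rfl⟩ hgen
    have h1 : σ₁ c = ξ := hgen.eq hξ
    have h2 : c = ξ₁ := by
      have : c ∈ σ₁ ⁻¹' {ξ} := h1
      rw [hfib] at this
      simpa using this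
    subst h2
    apply hne
    rw [hY₁]
    exact closure_minimal (Set.singleton_subset_iff.mpr hc) C.support.isClosed
  intro Q h0 hstep
  exact hstep X₁ X₂ σ₁ Y₁ C τ (h₁ Q h0 hstep) hτ hC himg hE1

/-- **ONE GENERAL E1-STEP, proper-subset form.** As `natChain_step`, with (ii) ∧ E1 replaced by the single hypothesis «the
special support of the centre is a PROPER subset of the current strict transform `Y₁`»: since `Y₁` lies in the special
fibre (`closure_subset_preimage_of_chain`; `Y` irreducible, closed, inside the special fibre), `Y₁ ⊆ supp C` would make the
special support of `C` equal to `Y₁`. [folklore] -/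
theorem natChain_step_of_ssubset {O : Type} [CommRing O] [IsLocalRing O] {P : AlgebraicGeometry.Scheme.{0}} (q : P ⟶ AlgebraicGeometry.Spec (.of O)) {Y : Set P} (hYirr : IsIrreducible Y) (hYcl : IsClosed Y) (hY : Y ⊆ q ⁻¹' {IsLocalRing.closedPoint O}) {X₁ X₂ : AlgebraicGeometry.Scheme.{0}} {σ₁ : X₁ ⟶ P} {Y₁ : Set X₁} (h₁ : ∀ Q : (∀ X' : AlgebraicGeometry.Scheme.{0}, (X' ⟶ P) → Set X' → Prop), Q P (CategoryTheory.CategoryStruct.id _) Y → (∀ (X' X'' : AlgebraicGeometry.Scheme.{0}) (σ' : X' ⟶ P) (Y' : Set X') (C : X'.IdealSheafData) (τ : X'' ⟶ X'), Q X' σ' Y' → Literature.AlgebraicGeometry.Resolution.IsBlowup τ C → Literature.AlgebraicGeometry.Resolution.Scheme.IsRegular C.subscheme → σ' '' (C.support : Set X') ⊆ {x | ¬ IsGenericPoint x Y} → (C.support : Set X') ∩ (CategoryTheory.CategoryStruct.comp σ' q) ⁻¹' {IsLocalRing.closedPoint O} ⊆ Y' → Q X'' (CategoryTheory.CategoryStruct.comp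 τ σ') (closure (τ ⁻¹' (Y' \ (C.support : Set X'))))) → Q X₁ σ₁ Y₁) {C : X₁.IdealSheafData} {τ : X₂ ⟶ X₁} (hτ : Literature.AlgebraicGeometry.Resolution.IsBlowup τ C) (hC : Literature.AlgebraicGeometry.Resolution.Scheme.IsRegular C.subscheme) (hss : (C.support : Set X₁) ∩ (CategoryTheory.CategoryStruct.comp σ₁ q) ⁻¹' {IsLocalRing.closedPoint O} ⊂ Y₁) :
    ∀ Q : (∀ X' : AlgebraicGeometry.Scheme.{0}, (X' ⟶ P) → Set X' → Prop), Q P (CategoryTheory.CategoryStruct.id _) Y → (∀ (X' X'' : AlgebraicGeometry.Scheme.{0}) (σ' : X' ⟶ P) (Y' : Set X') (C : X'.IdealSheafData) (τ : X'' ⟶ X'), Q X' σ' Y' → Literature.AlgebraicGeometry.Resolution.IsBlowup τ C → Literature.AlgebraicGeometry.Resolution.Scheme.IsRegular C.subscheme → σ' '' (C.support : Set X') ⊆ {x | ¬ IsGenericPoint x Y} → (C.support : Set X') ∩ (CategoryTheory.CategoryStruct.comp σ' q) ⁻¹' {IsLocalRing.closedPoint O} ⊆ Y' → Q X'' (CategoryTheory.CategoryStruct.comp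 τ σ') (closure (τ ⁻¹' (Y' \ (C.support : Set X'))))) → Q X₂ (CategoryTheory.CategoryStruct.comp τ σ₁) (closure (τ ⁻¹' (Y₁ \ (C.support : Set X₁)))) := by
  obtain ⟨ξ, hξ⟩ : ∃ ξ : P, IsGenericPoint ξ Y := QuasiSober.sober hYirr hYcl
  have hch : Chain P Y X₁ σ₁ Y₁ := chain_of_natChain q Y σ₁ Y₁ h₁
  -- `Y₁ = closure {ξ₁}` lies in the special fibre (as `closure_subset_preimage_of_chain` of Theorems/…ResolveOnePointDimOne.lean)
  obtain ⟨ξ₁, hfib, hY₁⟩ := hch.fibre hξ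
  have hσξ₁ : σ₁ ξ₁ = ξ := by
    have : ξ₁ ∈ σ₁ ⁻¹' {ξ} := by rw [hfib]; rfl
    simpa using this
  have hsub : Y₁ ⊆ (CategoryTheory.CategoryStruct.comp σ₁ q) ⁻¹' {IsLocalRing.closedPoint O} := by
    have hcl : IsClosed ((σ₁ ≫ q) ⁻¹' {IsLocalRing.closedPoint O}) :=
      (IsLocalRing.isClosed_singleton_closedPoint O).preimage (σ₁ ≫ q).continuous
    rw [hY₁]
    refine closure_minimal (Set.singleton_subset_iff.mpr ?_) hcl
    show (σ₁ ≫ q) ξ₁ ∈ ({IsLocalRing.closedPoint O} : Set _)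
    rw [Scheme.Hom.comp_apply, hσξ₁]
    exact hY hξ.mem
  refine natChain_step q hξ h₁ hτ hC hss.le fun hle => hss.ne ?_
  exact Set.Subset.antisymm hss.le (Set.subset_inter hle hsub)

end Summit.ResolutionOfSingularities.ResolutionOfSingularities.Cruxes.EquisingularLiftNat.Sections

end
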